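import Summits.HodgeConjecture.HodgeConjecture.Theorems.VHCAbelianSchemesRoadExtJumpLocusLinearisedTwist
import Literature.AlgebraicGeometry.Modules.PullbackTensorProductHolds
import HarnessLib

/-!
# Route 2T step (i) and the (N-U♭) consumer, UNCONDITIONAL: the two named facts of
# `VHCAbelianSchemesRoadExtJumpLocusLinearisedTwist` §6 are tree theorems

Sequel (a NEW sibling file — the parent `Theorems/VHCAbelianSchemesRoadExtJumpLocusLinearisedTwist.lean` has 399 lines and is
byte-unchanged) of §6 of that file: its two fact-bound corollaries `…_of_facts (hPT : PullbackTensorObjIso) (hInv :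
LocallyFreeRankOneIsInvertible)` are restated with BOTH hypotheses discharged BY NAME, since both named facts are now theorems
of the tree:

* `Literature.AlgebraicGeometry.Modules.PullbackTensorObjIso_holds : PullbackTensorObjIso` (The Stacks Project, Tag 01CD, for
  arbitrary modules; `Literature/AlgebraicGeometry/Modules/PullbackTensorProductHolds.lean`);
* `Literature.AlgebraicGeometry.Modules.LocallyFreeRankOneIsInvertible_holds : LocallyFreeRankOneIsInvertible` (Tag 0B8M;
  `Literature/AlgebraicGeometry/Modules/InvertibleModule.lean`).

Hence `mem_extJumpLocus_tensor_iff_of_mem_torsionPoints_unconditional` (2T step (i): `x ∈ J(N ⊗ E•) ↔ x ∈ J(E•)` for `N` finite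
locally free of rank one with `[det N] = γⁿ`, `x ∈ A[m](ℂ)`, `m ∣ n`) and
`not_mem_extJumpLocus_quotientPullback_of_quasiIso_tensor_unconditional` (the (N-U♭) consumer) carry NO named-fact hypothesis.
Two one-line specialisations; no new definition, no new obligation; helper lane of crux 26512 (width toward the crux = 0).

HONEST LABEL: research route conditional on HC_CM; not a corollary; Q11.4-sentence-2 already refuted in dim ≥ 3. Nothing in this
file says that (π), (N-U), any stub, the crux 26512, road №4, HC_AV, HC_CM or HC holds; HC_CM is HELD, by name only.

## References

* The Stacks Project, Tag 01CD (pull-back commutes with tensor product), Tag 0B8M (invertible modules; Definition 01CS). [StacksProject]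
* E. Markman, *Cycles on abelian 2n-folds of Weil type from secant sheaves on abelian n-folds*, arXiv:2502.03415, §9.3,
  Rem. 9.3.7 and Lemma 9.3.5. [Markman2025SecantWeil]
* H. Lange, *Abelian Varieties over the Complex Numbers* (2023), Thm. 1.3.5 and Prop. 1.4.6 (b). [Lange2023AbelianVarietiesC]
-/

noncomputable section

-- `TopCat.Presheaf`/`Scheme.Modules` are not reducible (as in Mathlib's `AlgebraicGeometry/Modules/Sheaf.lean`).
set_option backward.isDefEq.respectTransparency false

open CategoryTheory CategoryTheory.Limits AlgebraicGeometry

namespace Summit.HodgeConjecture.HodgeConjecture.Ring2.SemiregularRepresentatives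

set_option linter.dupNamespace false -- the cell's namespace repeats the summit name, as in every `Ring2*` file

namespace NowhereDisplaceable

open Literature.AlgebraicGeometry Literature.AlgebraicGeometry.Motives Literature.AlgebraicGeometry.Motives.AbelianVariety
open Literature.AlgebraicGeometry.Modules Literature.AlgebraicGeometry.AbelianVarieties Literature.Algebra.Homology
open Summit.HodgeConjecture.HodgeConjecture.Ring2.SemiregularRepresentatives.MoverTrap

/-! ## §8 UNCONDITIONAL forms of §6: the two named facts are tree theorems
(`Modules.PullbackTensorObjIso_holds`, Stacks 01CD; `Modules.LocallyFreeRankOneIsInvertible_holds`, Stacks 0B8M). -/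

/-- **2T STEP (i), UNCONDITIONAL**: §6 `mem_extJumpLocus_tensor_iff_of_mem_torsionPoints_of_facts` with both named facts
discharged by name (`PullbackTensorObjIso_holds`, `LocallyFreeRankOneIsInvertible_holds`): for `N` finite locally free of rank one on a
complex abelian variety `A` with `[det N] = γⁿ`, `x ∈ A[m](ℂ)`, `m ∣ n`, and any cochain complex `E•`, `x ∈ J(N ⊗ E•) ↔ x ∈ J(E•)`.
[cite: StacksProject, Tag 01CD and Tag 0B8M] [cite: Markman2025SecantWeil, §9.3 Rem. 9.3.7 and Lemma 9.3.5]
[cite: Lange2023AbelianVarietiesC, Thm. 1.3.5 and Prop. 1.4.6 (b)] -/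
theorem mem_extJumpLocus_tensor_iff_of_mem_torsionPoints_unconditional (A : AbelianVariety ℂ) {N : A.X.left.Modules}
    (hN : IsFiniteLocallyFree N) (h₁ : HasRank N 1) {γ : CechPic A.X.left} {m n : ℤ} (hmn : m ∣ n) (hγ : detClass hN = γ ^ n)
    {x : A.Points ℂ} (hx : x ∈ A.torsionPoints ℂ m) (E : CochainComplex A.X.left.Modules ℤ) :
    haveI := preservesZeroMorphisms_tensorBifunctor_obj N
    x ∈ extJumpLocus A ((((tensorBifunctor A.X.left).obj N).mapHomologicalComplex (ComplexShape.up ℤ)).obj E) ↔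
      x ∈ extJumpLocus A E :=
  mem_extJumpLocus_tensor_iff_of_mem_torsionPoints_of_facts PullbackTensorObjIso_holds LocallyFreeRankOneIsInvertible_holds
    A hN h₁ hmn hγ hx E

/-- **(N-U♭) consumes, UNCONDITIONAL**: §6 `not_mem_extJumpLocus_quotientPullback_of_quasiIso_tensor_of_facts` with both named facts
discharged by name: on `P = J × Ĵ`, a quasi-isomorphism `q^*E• ⟶ N ⊗ 𝓔` with `N` rank-one finite locally free, `[det N] = γⁿ`, a torsion
point `p ∈ P[m](ℂ)`, `m ∣ n`, and `p ∉ J(𝓔)` give `p ∉ J(q^*E•)`. [cite: StacksProject, Tag 01CD and Tag 0B8M]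
[cite: Markman2025SecantWeil, §9.3 Rem. 9.3.7 and Lemma 9.3.5] -/
theorem not_mem_extJumpLocus_quotientPullback_of_quasiIso_tensor_unconditional (D : SecantQuotientDatum)
    (E : CochainComplex D.Y.X.left.Modules ℤ) {N : D.P.X.left.Modules} (hN : IsFiniteLocallyFree N) (h₁ : HasRank N 1)
    {γ : CechPic D.P.X.left} {m n : ℤ} (hmn : m ∣ n) (hγ : detClass hN = γ ^ n) {p : D.P.Points ℂ}
    (hp : p ∈ D.P.torsionPoints ℂ m) (𝓔 : CochainComplex D.P.X.left.Modules ℤ)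
    (f : haveI := preservesZeroMorphisms_tensorBifunctor_obj N
      quotientPullbackComplex D E ⟶ (((tensorBifunctor D.P.X.left).obj N).mapHomologicalComplex (ComplexShape.up ℤ)).obj 𝓔)
    (hf : haveI := preservesZeroMorphisms_tensorBifunctor_obj N; QuasiIso f) (h𝓔 : p ∉ extJumpLocus D.P 𝓔) :
    p ∉ extJumpLocus D.P (quotientPullbackComplex D E) :=
  not_mem_extJumpLocus_quotientPullback_of_quasiIso_tensor_of_facts PullbackTensorObjIso_holds LocallyFreeRankOneIsInvertible_holds
    D E hN h₁ hmn hγ hp 𝓔 f hf h𝓔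

end NowhereDisplaceable

end Summit.HodgeConjecture.HodgeConjecture.Ring2.SemiregularRepresentatives

end
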